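import Literature.AnabelianGeometry.AbsoluteAnabelian.LogFrobeniusPanalocalizationIdentityCor55vi
import Literature.AnabelianGeometry.AbsoluteAnabelian.LogFrobeniusSettingProdShiftAction
import HarnessLib

/-!
# [AbsTopIII] Cor 5.5 (vi) at the identity panalocalization of the GENUINE carriers — zero binders (F-3140)

S. Mochizuki, *Topics in Absolute Anabelian Geometry III*, Cor 5.5 (vi) p. 132 (manuscript `paper:url-5493eb38cbb7`).
PROOF-ONLY coda (abc-iut-L4-t8 gen 12; L4-lead m166 (3)) of `LogFrobeniusPanalocalizationIdentityCor55vi.lean`: there,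
`cor55Panalocalization_identity_of_cor55ShiftAction (h : L.Cor55ShiftAction) : (identity L).Cor55Panalocalization` for every
setting `L`; abc-iut-f-102's THEOREM B (`LogFrobeniusGenuineCor55ShiftAction.lean`) and abc-iut-w6-d025's product theorem
(`LogFrobeniusSettingProdShiftAction.lean`) PRODUCE `Cor55ShiftAction` (F-0157) with ZERO binders at the genuine carriers of
record (`V(F_mod) ≠ ∅`).  Hence the typed Cor 5.5 (vi) assumption `Cor55Panalocalization` (F-3140) HOLDS, with zero binders,
at the identity panalocalization of: the genuine nonarchimedean MLF carrier `nonarchGenuine p` (𝒳 = `TFModel p`), every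
sub-model carrier `nonarchGenuineOver p ι` (in particular the slim one), and the genuine two-sided carrier
`genuineTwoSided p 𝔄`.  HONEST LABEL: the IDENTITY panalocalization `D• → D•` (print's case `D⊚ = D✠`) at genuine
carriers — not the printed statement for a genuine `D⊚ → D✠` between distinct global/panalocal data; no side taken on
[IUTchIII] Cor 3.12; typed ≠ proved beyond what the kernel checks here.
-/

set_option autoImplicit false

noncomputable section

open CategoryTheory

namespace Literature.AnabelianGeometry.AbsoluteAnabelian

namespace Panalocalization

open LogFrobeniusSetting AbsTopIII

/-- ★ **Cor 5.5 (vi) HOLDS (zero binders) at the identity panalocalization of the genuine nonarchimedean MLF carrier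
`nonarchGenuine p`** (`V(F_mod) ≠ ∅`; F-0157 there is f-102's `nonarchGenuine_cor55ShiftAction`).
[cite: MochizukiAbsTopIII2015, Cor 5.5 (vi) p. 132] -/
theorem cor55Panalocalization_identity_nonarchGenuine (p : ℕ) [Fact p.Prime] (Vmod : Type 1) (isArc : Vmod → Bool)
    [Nonempty Vmod] : (identity (nonarchGenuine p Vmod isArc)).Cor55Panalocalization :=
  cor55Panalocalization_identity_of_cor55ShiftAction _ (nonarchGenuine_cor55ShiftAction p Vmod isArc)

/-- ★ **Cor 5.5 (vi) HOLDS (zero binders) at the identity panalocalization of every sub-model carrier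
`nonarchGenuineOver p ι`** (`ι : C ⥤ TFModel p`; `V(F_mod) ≠ ∅`). [cite: MochizukiAbsTopIII2015, Cor 5.5 (vi) p. 132] -/
theorem cor55Panalocalization_identity_nonarchGenuineOver (p : ℕ) [Fact p.Prime] {C : Type 1} [Category.{1} C]
    (ι : C ⥤ TFModel p) (Vmod : Type 1) (isArc : Vmod → Bool) [Nonempty Vmod] :
    (identity (nonarchGenuineOver p ι Vmod isArc)).Cor55Panalocalization :=
  cor55Panalocalization_identity_of_cor55ShiftAction _ (nonarchGenuineOver_cor55ShiftAction p ι Vmod isArc)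

/-- Cor 5.5 (vi) HOLDS (zero binders) at the identity panalocalization of the SLIM genuine-nonarchimedean carrier.
[cite: MochizukiAbsTopIII2015, Cor 5.5 (vi) p. 132] -/
theorem cor55Panalocalization_identity_nonarchGenuineSlim (p : ℕ) [Fact p.Prime] (Vmod : Type 1) (isArc : Vmod → Bool)
    [Nonempty Vmod] : (identity (nonarchGenuineSlim p Vmod isArc)).Cor55Panalocalization :=
  cor55Panalocalization_identity_of_cor55ShiftAction _ (nonarchGenuineSlim_cor55ShiftAction p Vmod isArc)

/-- ★ **Cor 5.5 (vi) HOLDS (zero binders) at the identity panalocalization of the genuine TWO-SIDED carrier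
`genuineTwoSided p 𝔄`** (nonarchimedean MLF models × the archimedean Aut-holomorphic field functor `𝔄`; F-0157 there is
abc-iut-w6-d025's `genuineTwoSided_cor55ShiftAction`). [cite: MochizukiAbsTopIII2015, Cor 5.5 (vi) p. 132] -/
theorem cor55Panalocalization_identity_genuineTwoSided (p : ℕ) [Fact p.Prime] (𝔄 : AutHolFieldFunctor.{0}) (Vmod : Type 1)
    (isArc : Vmod → Bool) [Nonempty Vmod] : (identity (genuineTwoSided p 𝔄 Vmod isArc)).Cor55Panalocalization :=
  cor55Panalocalization_identity_of_cor55ShiftAction _ (genuineTwoSided_cor55ShiftAction p 𝔄 Vmod isArc)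

end Panalocalization

end Literature.AnabelianGeometry.AbsoluteAnabelian

end
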